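import Literature.AlgebraicGeometry.PlaneCurves.HessePencilCharacteristicThree
import Literature.AlgebraicGeometry.PlaneCurves.HessePencilCharacteristicThreeWeierstrass
import Literature.AlgebraicGeometry.PlaneCurves.WeierstrassLineIntersectionCycle
import HarnessLib

/-!
# `g₁` is a translation by a `3`-torsion point in characteristic `3`, zero `(1, −1, 0)` (Artebani–Dolgachev, Remark 5.5)

Topic `Literature/AlgebraicGeometry/PlaneCurves`, namespace `Literature.AlgebraicGeometry.PlaneCurves`.
Lane `lit-hodgefound`, seat `lit-hodgefound-p37`, row g21-#4; the sequel of
`HessePencilCharacteristicThreeWeierstrass` (g21-#3: for `3 = 0`, `t ≠ 0`, `E_t ∘ M_t = −W₃[t]` with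
`M_t(0, 1, 0) = t⁻¹·(1, −1, 0)`), `HessePencilCharacteristicThree` (g21-#1: `E_t(p)`, `∇E_t = t·(yz, xz, xy)`)
and `WeierstrassLineIntersectionCycle` (g20-#1: Kunz Cor. 10.7 with multiplicities for Mathlib's group
law), following the architecture of the seat's `HessePencilGroupLaw` (g20-#3: the translation principle
for `3 ≠ 0`).  Everything here is PROVED; no definition, no named fact.

Source followed — M. Artebani, I. Dolgachev, *The Hesse pencil of plane cubic curves*,
L'Enseignement Math. (2) 55 (2009) 235–273, §5, Remark 5.5 [arXiv:math/0611590, held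
`paper:arxiv-math_0611590` p0011 L46], VERBATIM:

> Remark 5.5. In characteristic 3 the cyclic group of projective transformations generated by `g₁`
> acts on nonsingular members of the Hesse pencil as translation by 3-torsion points with the zero
> point taken to be `(1, −1, 0)`.

(`g₁(x, y, z) = (y, z, x)`, §4; "`p ⊕ q` is the unique point `r` such that `p₀, r` and the third point
of intersection in `p̄q̄ ∩ E` lie on a line", §2.)

## The argument

`K` a field with `3 = 0`, `t ≠ 0`; `E_t = X³ + Y³ + Z³ + tXYZ` is nonsingular (g21-#1) with Weierstrass
model `W₃[t] = ⟨−t, 0, 0, 0, t³⟩` through `M_t` (g21-#3), zero `o = (1, −1, 0) ∥ M_t(0, 1, 0)`.  A point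
`P ∈ W₃[t](K)` has the Hesse point `M vec P` (`vec O = (0, 1, 0)`, `vec (x, y) = (x, y, 1)`); every
non-zero zero of `E_t` is `c · M vec P` for exactly one `P` (§1).  Let `t₀ = (1, 0, −1)` (a base point,
a flex: its tangent `y = 0` meets `E_t` in `(x + z)³ = 0` only), `T` the point over it: `3T = O`.  For
`p = (x, y, z) ∈ E_t` the third point of the line `p̄t̄₀` is `σp = (z, y, x)` and the third point of the
line through `o` and `σp` is `(y, z, x) = g₁p`: indeed `det[p; t₀; σp] = 0` and `det[o; σp; g₁p] = 0`
IDENTICALLY (§2), the coincident cases being tangencies (`⟨∇E_t(p), t₀⟩ = t·y·(z − x)`,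
`⟨∇E_t(σp), o⟩ = t·x·(y − z)`).  Two applications of Cor. 10.7 with multiplicities (g20-#1) give
`P + T + S = O` and `O + S + Q = O` for the points `S, Q` over `σp, g₁p`, i.e. `Q = P + T` (§3, §4).

## What is here

* §1 (transport along `M_t`) `charThree_grad_M_dotProduct` (`⟨∇E_t(Mv), Mw⟩ = −⟨∇W₃[t](v), w⟩`),
  `charThreePoint_ne_zero_and_eval`, `exists_point_of_hesseE_charThree`, `point_eq_of_charThreePoint_smul`
  (private helpers: `det[Ma; Mb; Mc] = det M · det[a; b; c]`, scaling lemmas, matrix images).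
* §2 (incidences, any field) `det_p_t₀_σ`, `det_o_σ_g₁`, `hesseE_grad_dotProduct_t₀_of_three_eq_zero`,
  `hesseE_grad_dotProduct_o_of_three_eq_zero`, `hesseE_inflectionTangent_t₀_of_three_eq_zero` (the
  tangent at `t₀` meets `E_t` only at `t₀`).
* §3 `charThree_translation_principle` (the seat's g20-#3 principle for `M_t` and the zero `M_t(0,1,0)`).
* §4 **`exists_point_t₀_charThree`**, **`three_nsmul_T₀_charThree`** (`3T = O`) and
  **`hesseE_translation_g₁_iff_of_three_eq_zero`**: for all `P, Q ∈ W₃[t](K)`, `M vec Q ∥ g₁(M vec P)`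
  iff `Q = P + T` — Remark 5.5: `g₁` IS the translation by the `3`-torsion point `T` over `(1, 0, −1)`,
  zero `(1, −1, 0)`.
* §5 **`hesseE_two_nsmul_T₀_charThree`** (`2T` lies over `(0, 1, −1)`) and
  **`hesseE_basePoint_iff_charThree`** (the Hesse point of `P` is a base point — on `xyz = 0` — iff
  `P ∈ {O, T, 2T}`; these are `3`-torsion): Remark 2.1's three base points are the `⟨g₁⟩`-orbit of the zero.

## References
* [ArtebaniDolgachev2009] M. Artebani, I. Dolgachev, *The Hesse pencil of plane cubic curves*,
  Enseign. Math. (2) 55 (2009) 235–273, §5 Remark 5.5; §2 (the group law); §4 (`g₁`).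
* [Kunz2005PlaneAlgebraicCurves] E. Kunz, *Introduction to Plane Algebraic Curves*, Birkhäuser 2005,
  Ch. 10, Cor. 10.7.
-/

set_option autoImplicit false

open MvPolynomial Matrix
open Literature.AlgebraicGeometry.HyperbolicPolynomials

namespace Literature.AlgebraicGeometry.PlaneCurves

universe u

/-- The member `E_t = X³ + Y³ + Z³ + t·XYZ` (local notation, no definition). -/
local notation3 "𝐄[" t "]" =>
  (X 0 ^ 3 + X 1 ^ 3 + X 2 ^ 3 + C t * (X 0 * X 1 * X 2) : MvPolynomial (Fin 3) _)

/-- `M_t = [[0, t⁻¹, 0], [1, −t⁻¹, 0], [0, 0, t]]` (g21-#3; local notation). -/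
local notation3 "𝐌[" t "]" =>
  (Matrix.of ![![(0 : _), t⁻¹, 0], ![1, -t⁻¹, 0], ![0, 0, t]] : Matrix (Fin 3) (Fin 3) _)

/-- `W₃[t] = ⟨−t, 0, 0, 0, t³⟩` (g21-#3; local notation). -/
local notation3 "𝐖₃[" t "]" =>
  ({ a₁ := -t, a₂ := 0, a₃ := 0, a₄ := 0, a₆ := t ^ 3 } : WeierstrassCurve _)

/-- `g₁ = (y, z, x)`, `σ = (z, y, x)` (local notations, no definitions). -/
local notation3 "𝐠₁" => (Matrix.of ![![(0 : _), 1, 0], ![0, 0, 1], ![1, 0, 0]] : Matrix (Fin 3) (Fin 3) _)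
local notation3 "𝛔" => (Matrix.of ![![(0 : _), 0, 1], ![0, 1, 0], ![1, 0, 0]] : Matrix (Fin 3) (Fin 3) _)

section CharThreeTranslation

variable {K : Type u} [Field K]

/-! ## §1 Transport along `M_t` -/

/-- `g₁ v = (v₁, v₂, v₀)` and `σ v = (v₂, v₁, v₀)`. [folklore] -/
private theorem mulVec_g₁_σ (v : Fin 3 → K) :
    (𝐠₁ : Matrix (Fin 3) (Fin 3) K) *ᵥ v = ![v 1, v 2, v 0] ∧
      (𝛔 : Matrix (Fin 3) (Fin 3) K) *ᵥ v = ![v 2, v 1, v 0] := by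
  constructor <;>
  · funext i; fin_cases i <;> simp [Matrix.mulVec, dotProduct, Fin.sum_univ_three]

/-- `M_t (0, 1, 0) = (t⁻¹, −t⁻¹, 0)`. [folklore] -/
private theorem charThreeM_mulVec_e₁ (t : K) :
    (𝐌[t] : Matrix (Fin 3) (Fin 3) K) *ᵥ ![0, 1, 0] = ![t⁻¹, -t⁻¹, 0] := by
  funext i; fin_cases i <;> simp [Matrix.mulVec, dotProduct, Fin.sum_univ_three]

/-- Scalars in a row of a `3 × 3` determinant. [folklore] -/
private theorem det_rows_smul₃ (c : K) (a b d : Fin 3 → K) :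
    (Matrix.of ![a, c • b, d]).det = c * (Matrix.of ![a, b, d]).det ∧
      (Matrix.of ![a, b, c • d]).det = c * (Matrix.of ![a, b, d]).det ∧
      (Matrix.of ![c • a, b, d]).det = c * (Matrix.of ![a, b, d]).det := by
  refine ⟨?_, ?_, ?_⟩ <;>
  · rw [Matrix.det_fin_three, Matrix.det_fin_three]
    simp
    ring

/-- Scaling a point: `E_t(c·p) = c³E_t(p)`, `⟨∇E_t(c·p), q⟩ = c²⟨∇E_t(p), q⟩`. [folklore] -/
private theorem hesseE_eval_grad_smul (t c : K) (p q : Fin 3 → K) :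
    eval (c • p) 𝐄[t] = c ^ 3 * eval p 𝐄[t] ∧
      (fun i => eval (c • p) (pderiv i 𝐄[t])) ⬝ᵥ q = c ^ 2 * ((fun i => eval p (pderiv i 𝐄[t])) ⬝ᵥ q) := by
  rw [hesseE_eval, hesseE_eval, hesseE_eval_pderiv, hesseE_eval_pderiv]
  simp [dotProduct, Fin.sum_univ_three]
  constructor <;> ring

/-- Tangent transport along `M_t`: `⟨∇E_t(M_t v), M_t w⟩ = −⟨∇W₃[t](v), w⟩` (`3 = 0`, `t ≠ 0`;
`HessianCovariance.grad_bind₁_toMvPolynomial_dotProduct` and g21-#3). [cite: ArtebaniDolgachev2009,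
§5, Remark 5.5 (the zero point `(1, −1, 0)`)] -/
theorem charThree_grad_M_dotProduct (h3 : (3 : K) = 0) {t : K} (ht : t ≠ 0) (v w : Fin 3 → K) :
    (fun i => eval ((𝐌[t] : Matrix (Fin 3) (Fin 3) K) *ᵥ v) (pderiv i 𝐄[t])) ⬝ᵥ
        ((𝐌[t] : Matrix (Fin 3) (Fin 3) K) *ᵥ w) =
      -((fun j => eval v (pderiv j (𝐖₃[t] : WeierstrassCurve K).toProjective.polynomial)) ⬝ᵥ w) := by
  rw [← grad_bind₁_toMvPolynomial_dotProduct, hesseE_bind₁_charThree h3 ht]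
  simp only [dotProduct, map_neg, Finset.sum_neg_distrib, neg_mul]

/-- Collinearity transport: `det[M a; M b; M c] = det M · det[a; b; c]`. [folklore] -/
private theorem det_rows_charThreeM_mulVec (t : K) (a b c : Fin 3 → K) :
    (Matrix.of ![(𝐌[t] : Matrix (Fin 3) (Fin 3) K) *ᵥ a, (𝐌[t] : Matrix (Fin 3) (Fin 3) K) *ᵥ b,
      (𝐌[t] : Matrix (Fin 3) (Fin 3) K) *ᵥ c]).det =
      (𝐌[t] : Matrix (Fin 3) (Fin 3) K).det * (Matrix.of ![a, b, c]).det := by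
  rw [Matrix.det_fin_three, Matrix.det_fin_three, Matrix.det_fin_three]
  simp [dotProduct, Fin.sum_univ_three]
  ring

variable {t : K} (vec : (𝐖₃[t] : WeierstrassCurve K).toAffine.Point → Fin 3 → K)

/-- **Every point of `W₃[t](K)` gives a point of `E_t(K)`**: `M_t vec P ≠ 0` and `E_t(M_t vec P) = 0`
(`3 = 0`, `t ≠ 0`). [cite: ArtebaniDolgachev2009, §5, Remark 5.5] -/
theorem charThreePoint_ne_zero_and_eval (h3 : (3 : K) = 0) (ht : t ≠ 0) (hv0 : vec 0 = ![0, 1, 0])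
    (hvs : ∀ x y (h : (𝐖₃[t] : WeierstrassCurve K).toAffine.Nonsingular x y), vec (.some x y h) = ![x, y, 1])
    (P : (𝐖₃[t] : WeierstrassCurve K).toAffine.Point) :
    (𝐌[t] : Matrix (Fin 3) (Fin 3) K) *ᵥ vec P ≠ 0 ∧
      eval ((𝐌[t] : Matrix (Fin 3) (Fin 3) K) *ᵥ vec P) 𝐄[t] = 0 := by
  have hdet : (𝐌[t] : Matrix (Fin 3) (Fin 3) K).det ≠ 0 := by
    rw [charThree_matrix_det ht]; norm_num
  constructor
  · intro h
    have h' : vec P = 0 := by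
      have := congrArg (fun w => (𝐌[t] : Matrix (Fin 3) (Fin 3) K)⁻¹ *ᵥ w) h
      simp only [Matrix.mulVec_mulVec, Matrix.nonsing_inv_mul _ (isUnit_iff_ne_zero.2 hdet),
        Matrix.one_mulVec, Matrix.mulVec_zero] at this
      exact this
    rcases P with _ | ⟨x, y, h⟩
    · rw [← WeierstrassCurve.Affine.Point.zero_def, hv0] at h'
      simpa using congrFun h' 1
    · rw [hvs] at h'
      simpa using congrFun h' 2
  · rw [hesseE_eval_charThree_mulVec h3 ht]
    rcases P with _ | ⟨x, y, h⟩
    · rw [← WeierstrassCurve.Affine.Point.zero_def, hv0]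
      have : eval ![(0 : K), 1, 0] (𝐖₃[t] : WeierstrassCurve K).toProjective.polynomial = 0 :=
        WeierstrassCurve.Projective.equation_zero
      rw [this, neg_zero]
    · rw [hvs]
      have : eval ![x, y, 1] (𝐖₃[t] : WeierstrassCurve K).toProjective.polynomial = 0 :=
        (WeierstrassCurve.Projective.equation_some x y).2 h.1
      rw [this, neg_zero]

/-- **Every point of `E_t(K)` comes from exactly one point of `W₃[t](K)`, existence**: a vector `p ≠ 0`
with `E_t(p) = 0` is `c · M_t vec P`, `c ≠ 0` (`3 = 0`, `t ≠ 0`). [cite: ArtebaniDolgachev2009, §5,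
Remark 5.5; §2, Remark 2.1 (nonsingular members)] -/
theorem exists_point_of_hesseE_charThree (h3 : (3 : K) = 0) (ht : t ≠ 0) (hv0 : vec 0 = ![0, 1, 0])
    (hvs : ∀ x y (h : (𝐖₃[t] : WeierstrassCurve K).toAffine.Nonsingular x y), vec (.some x y h) = ![x, y, 1])
    {p : Fin 3 → K} (hp : p ≠ 0) (hE : eval p 𝐄[t] = 0) :
    ∃ (P : (𝐖₃[t] : WeierstrassCurve K).toAffine.Point) (c : K),
      c ≠ 0 ∧ p = c • ((𝐌[t] : Matrix (Fin 3) (Fin 3) K) *ᵥ vec P) := by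
  haveI hEl : (𝐖₃[t] : WeierstrassCurve K).IsElliptic := (charThree_weierstrass_isElliptic_iff h3 t).2 ht
  have hdet : (𝐌[t] : Matrix (Fin 3) (Fin 3) K).det ≠ 0 := by
    rw [charThree_matrix_det ht]; norm_num
  set v : Fin 3 → K := (𝐌[t] : Matrix (Fin 3) (Fin 3) K)⁻¹ *ᵥ p with hv
  have hMv : (𝐌[t] : Matrix (Fin 3) (Fin 3) K) *ᵥ v = p := by
    rw [hv, Matrix.mulVec_mulVec, Matrix.mul_nonsing_inv _ (isUnit_iff_ne_zero.2 hdet),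
      Matrix.one_mulVec]
  have hvne : v ≠ 0 := fun h => hp (by rw [← hMv, h, Matrix.mulVec_zero])
  have hWv : (𝐖₃[t] : WeierstrassCurve K).toProjective.Equation v := by
    have h := hesseE_eval_charThree_mulVec h3 ht v
    rw [hMv, hE] at h
    exact neg_eq_zero.1 h.symm
  by_cases hz : v 2 = 0
  · have hx : v 0 = 0 :=
      (pow_eq_zero_iff three_ne_zero).1 ((WeierstrassCurve.Projective.equation_of_Z_eq_zero hz).1 hWv)
    have hv1 : v 1 ≠ 0 := by
      intro h1; apply hvne
      funext i; fin_cases i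
      · exact hx
      · exact h1
      · exact hz
    refine ⟨0, v 1, hv1, ?_⟩
    rw [hv0, ← Matrix.mulVec_smul, ← hMv]
    congr 1
    funext i; fin_cases i <;> simp [hx, hz]
  · have heq : (𝐖₃[t] : WeierstrassCurve K).toAffine.Equation (v 0 / v 2) (v 1 / v 2) :=
      (WeierstrassCurve.Projective.equation_of_Z_ne_zero hz).1 hWv
    have hns : (𝐖₃[t] : WeierstrassCurve K).toAffine.Nonsingular (v 0 / v 2) (v 1 / v 2) :=
      (WeierstrassCurve.Affine.equation_iff_nonsingular
        (W := (𝐖₃[t] : WeierstrassCurve K).toAffine)).1 heq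
    refine ⟨.some _ _ hns, v 2, hz, ?_⟩
    rw [hvs, ← Matrix.mulVec_smul, ← hMv]
    congr 1
    funext i; fin_cases i
    · simp; rw [mul_div_assoc', mul_div_cancel_left₀ _ hz]
    · simp; rw [mul_div_assoc', mul_div_cancel_left₀ _ hz]
    · simp

/-- **… uniqueness**: if `M_t vec P = c · M_t vec Q` then `P = Q` (`t ≠ 0`).
[cite: ArtebaniDolgachev2009, §5, Remark 5.5] -/
theorem point_eq_of_charThreePoint_smul (ht : t ≠ 0) (hv0 : vec 0 = ![0, 1, 0])
    (hvs : ∀ x y (h : (𝐖₃[t] : WeierstrassCurve K).toAffine.Nonsingular x y), vec (.some x y h) = ![x, y, 1])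
    {P Q : (𝐖₃[t] : WeierstrassCurve K).toAffine.Point} {c : K}
    (h : (𝐌[t] : Matrix (Fin 3) (Fin 3) K) *ᵥ vec P = c • ((𝐌[t] : Matrix (Fin 3) (Fin 3) K) *ᵥ vec Q)) :
    P = Q := by
  have hdet : (𝐌[t] : Matrix (Fin 3) (Fin 3) K).det ≠ 0 := by
    rw [charThree_matrix_det ht]; norm_num
  have h' : vec P = c • vec Q := by
    have := congrArg (fun w => (𝐌[t] : Matrix (Fin 3) (Fin 3) K)⁻¹ *ᵥ w) h
    simp only [Matrix.mulVec_mulVec, Matrix.mulVec_smul,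
      Matrix.nonsing_inv_mul _ (isUnit_iff_ne_zero.2 hdet), Matrix.one_mulVec] at this
    exact this
  rcases P with _ | ⟨x, y, hP⟩ <;> rcases Q with _ | ⟨x', y', hQ⟩
  · rfl
  · rw [← WeierstrassCurve.Affine.Point.zero_def, hv0, hvs] at h'
    have e2 : (0 : K) = c * 1 := by simpa using congrFun h' 2
    have e1 : (1 : K) = c * y' := by simpa using congrFun h' 1
    rw [mul_one] at e2
    rw [← e2, zero_mul] at e1
    exact absurd e1 one_ne_zero
  · rw [← WeierstrassCurve.Affine.Point.zero_def, hv0, hvs] at h'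
    have e2 : (1 : K) = c * 0 := by simpa using congrFun h' 2
    rw [mul_zero] at e2
    exact absurd e2 one_ne_zero
  · rw [hvs, hvs] at h'
    have e2 : (1 : K) = c * 1 := by simpa using congrFun h' 2
    have hc : c = 1 := by rw [mul_one] at e2; exact e2.symm
    have e0 : x = c * x' := by simpa using congrFun h' 0
    have e1 : y = c * y' := by simpa using congrFun h' 1
    rw [hc, one_mul] at e0 e1
    subst e0; subst e1; rfl

/-- The point of `E_t(K)` given by a matrix image (`g` preserving `E_t` pointwise, `det g ≠ 0`).
[cite: ArtebaniDolgachev2009, §5, Remark 5.5 (the group generated by `g₁` acts on the members)] -/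
private theorem exists_point_image₃ (h3 : (3 : K) = 0) (ht : t ≠ 0) (hv0 : vec 0 = ![0, 1, 0])
    (hvs : ∀ x y (h : (𝐖₃[t] : WeierstrassCurve K).toAffine.Nonsingular x y), vec (.some x y h) = ![x, y, 1])
    {g : Matrix (Fin 3) (Fin 3) K} (hg : ∀ p : Fin 3 → K, eval (g *ᵥ p) 𝐄[t] = eval p 𝐄[t])
    (hgdet : g.det ≠ 0) (P : (𝐖₃[t] : WeierstrassCurve K).toAffine.Point) :
    ∃ (Q : (𝐖₃[t] : WeierstrassCurve K).toAffine.Point) (c : K),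
      c ≠ 0 ∧ g *ᵥ ((𝐌[t] : Matrix (Fin 3) (Fin 3) K) *ᵥ vec P) =
        c • ((𝐌[t] : Matrix (Fin 3) (Fin 3) K) *ᵥ vec Q) := by
  obtain ⟨hne, hev⟩ := charThreePoint_ne_zero_and_eval vec h3 ht hv0 hvs P
  refine exists_point_of_hesseE_charThree vec h3 ht hv0 hvs ?_ (by rw [hg, hev])
  intro h0
  apply hne
  have := congrArg (fun w => g⁻¹ *ᵥ w) h0
  rwa [Matrix.mulVec_mulVec, Matrix.nonsing_inv_mul _ (isUnit_iff_ne_zero.2 hgdet),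
    Matrix.one_mulVec, Matrix.mulVec_zero] at this

/-! ## §2 The incidences of the chord–tangent recipe for `g₁`, zero `o = (1, −1, 0)` -/

/-- **`p, t₀, σp` are collinear** for `t₀ = (1, 0, −1)`, `σp = (z, y, x)`: `det[p; t₀; σp] = 0`
identically (any field) — `σp` is the third point of the line `p̄t̄₀` on every member.
[cite: ArtebaniDolgachev2009, §2 ("`p ⊕ q` is the unique point `r` such that `p₀, r` and the third
point of intersection in `p̄q̄ ∩ E` lie on a line")] -/
theorem det_p_t₀_σ (p : Fin 3 → K) :
    (Matrix.of ![p, ![(1 : K), 0, -1], (𝛔 : Matrix (Fin 3) (Fin 3) K) *ᵥ p]).det = 0 := by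
  rw [(mulVec_g₁_σ p).2, Matrix.det_fin_three]
  simp
  ring

/-- **`o, σp, g₁p` are collinear** for `o = (1, −1, 0)`: `det[o; σp; g₁p] = 0` identically, and the
same with `o` replaced by `M_t(0, 1, 0) = t⁻¹·o`. [cite: ArtebaniDolgachev2009, §2 (the group law:
"`p₀, r` and the third point … lie on a line"); §5, Remark 5.5 (zero point `(1, −1, 0)`)] -/
theorem det_o_σ_g₁ (t : K) (p : Fin 3 → K) :
    (Matrix.of ![![(1 : K), -1, 0], (𝛔 : Matrix (Fin 3) (Fin 3) K) *ᵥ p,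
        (𝐠₁ : Matrix (Fin 3) (Fin 3) K) *ᵥ p]).det = 0 ∧
      (Matrix.of ![(𝐌[t] : Matrix (Fin 3) (Fin 3) K) *ᵥ ![0, 1, 0], (𝛔 : Matrix (Fin 3) (Fin 3) K) *ᵥ p,
        (𝐠₁ : Matrix (Fin 3) (Fin 3) K) *ᵥ p]).det = 0 := by
  rw [(mulVec_g₁_σ p).1, (mulVec_g₁_σ p).2, charThreeM_mulVec_e₁, Matrix.det_fin_three,
    Matrix.det_fin_three]
  simp
  constructor <;> ring

/-- **The coincident case of the first line is a tangency**: for `3 = 0`,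
`⟨∇E_t(p), t₀⟩ = t·p₁·(p₂ − p₀)`; so if `σp ∥ p` (then `p₁ = 0` or `p₀ = p₂`) the line `p̄t̄₀` is the
tangent at `p`. [cite: ArtebaniDolgachev2009, §5, Remark 5.5] -/
theorem hesseE_grad_dotProduct_t₀_of_three_eq_zero (h3 : (3 : K) = 0) (t : K) (p : Fin 3 → K) :
    (fun i => eval p (pderiv i 𝐄[t])) ⬝ᵥ ![(1 : K), 0, -1] = t * p 1 * (p 2 - p 0) ∧
      (∀ c : K, (𝛔 : Matrix (Fin 3) (Fin 3) K) *ᵥ p = c • p →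
        (fun i => eval p (pderiv i 𝐄[t])) ⬝ᵥ ![(1 : K), 0, -1] = 0) := by
  have h1 : (fun i => eval p (pderiv i 𝐄[t])) ⬝ᵥ ![(1 : K), 0, -1] = t * p 1 * (p 2 - p 0) := by
    rw [hesseE_eval_pderiv_of_three_eq_zero h3]
    simp [dotProduct, Fin.sum_univ_three]
    ring
  refine ⟨h1, fun c hc => ?_⟩
  rw [h1]
  rw [(mulVec_g₁_σ p).2] at hc
  have e0 : p 2 = c * p 0 := by simpa using congrFun hc 0
  have e1 : p 1 = c * p 1 := by simpa using congrFun hc 1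
  have e2 : p 0 = c * p 2 := by simpa using congrFun hc 2
  by_cases hp1 : p 1 = 0
  · rw [hp1]; ring
  · have hc1 : c = 1 := by
      have : (c - 1) * p 1 = 0 := by linear_combination -e1
      exact sub_eq_zero.1 ((mul_eq_zero.1 this).resolve_right hp1)
    rw [hc1, one_mul] at e0
    rw [e0]; ring

/-- **The coincident case of the second line is a tangency**: for `3 = 0`,
`⟨∇E_t(q), o⟩ = t·q₂·(q₁ − q₀)` (`o = (1, −1, 0)`); so if `σp ∥ g₁p` then, with `q = σp = (z, y, x)`,
`x = 0` or `y = z`, and the line through `o` and `σp` is the tangent at `σp`.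
[cite: ArtebaniDolgachev2009, §5, Remark 5.5] -/
theorem hesseE_grad_dotProduct_o_of_three_eq_zero (h3 : (3 : K) = 0) (t : K) (p : Fin 3 → K) :
    (fun i => eval p (pderiv i 𝐄[t])) ⬝ᵥ ![(1 : K), -1, 0] = t * p 2 * (p 1 - p 0) ∧
      (∀ c : K, (𝛔 : Matrix (Fin 3) (Fin 3) K) *ᵥ p = c • ((𝐠₁ : Matrix (Fin 3) (Fin 3) K) *ᵥ p) →
        (fun i => eval ((𝛔 : Matrix (Fin 3) (Fin 3) K) *ᵥ p) (pderiv i 𝐄[t])) ⬝ᵥ ![(1 : K), -1, 0] = 0) := by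
  have h1 : ∀ q : Fin 3 → K,
      (fun i => eval q (pderiv i 𝐄[t])) ⬝ᵥ ![(1 : K), -1, 0] = t * q 2 * (q 1 - q 0) := fun q => by
    rw [hesseE_eval_pderiv_of_three_eq_zero h3]
    simp [dotProduct, Fin.sum_univ_three]
    ring
  refine ⟨h1 p, fun c hc => ?_⟩
  rw [h1, (mulVec_g₁_σ p).2]
  rw [(mulVec_g₁_σ p).1, (mulVec_g₁_σ p).2] at hc
  have e1 : p 1 = c * p 2 := by simpa using congrFun hc 1
  have e2 : p 0 = c * p 0 := by simpa using congrFun hc 2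
  have goal : t * p 0 * (p 1 - p 2) = 0 := by
    by_cases hp0 : p 0 = 0
    · rw [hp0]; ring
    · have hc1 : c = 1 := by
        have : (c - 1) * p 0 = 0 := by linear_combination -e2
        exact sub_eq_zero.1 ((mul_eq_zero.1 this).resolve_right hp0)
      rw [hc1, one_mul] at e1
      rw [e1]; ring
  simpa using goal

/-- **`t₀ = (1, 0, −1)` is a flex whose tangent meets `E_t` only at `t₀`** (`3 = 0`, `t ≠ 0`): the
tangent at `t₀` is `y = 0` (`∇E_t(t₀) = (0, −t, 0)`), and on it `E_t = x³ + z³ = (x + z)³`.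
[cite: ArtebaniDolgachev2009, §2, Remark 2.1 (the three base points are inflection points)] -/
theorem hesseE_inflectionTangent_t₀_of_three_eq_zero (h3 : (3 : K) = 0) {t : K} (ht : t ≠ 0)
    (q : Fin 3 → K) (hq : eval q 𝐄[t] = 0)
    (htan : (fun i => eval ![(1 : K), 0, -1] (pderiv i 𝐄[t])) ⬝ᵥ q = 0) :
    ∃ c : K, q = c • ![(1 : K), 0, -1] := by
  rw [hesseE_eval_pderiv_of_three_eq_zero h3] at htan
  simp [dotProduct, Fin.sum_univ_three, ht] at htan
  -- `htan : q 1 = 0`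
  rw [hesseE_eval, htan] at hq
  have hsum : (q 0 + q 2) ^ 3 = 0 := by
    rw [← cube_add_cube_of_three_eq_zero h3]; simpa using hq
  have h02 : q 2 = -q 0 := by
    have := (pow_eq_zero_iff three_ne_zero).1 hsum
    linear_combination this
  refine ⟨q 0, ?_⟩
  funext i; fin_cases i
  · simp
  · simp [htan]
  · simp [h02]

/-- `g₁` and `σ` preserve `E_t` pointwise; `σ² = 1`, `σ t₀ = −t₀`; their determinants.
[cite: ArtebaniDolgachev2009, §4 (`g₁`); §5, Remark 5.5] -/
theorem hesseE_eval_g₁_σ (t : K) :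
    (∀ p : Fin 3 → K, eval ((𝐠₁ : Matrix (Fin 3) (Fin 3) K) *ᵥ p) 𝐄[t] = eval p 𝐄[t]) ∧
      (∀ p : Fin 3 → K, eval ((𝛔 : Matrix (Fin 3) (Fin 3) K) *ᵥ p) 𝐄[t] = eval p 𝐄[t]) ∧
      (𝛔 : Matrix (Fin 3) (Fin 3) K) * 𝛔 = 1 ∧
      (𝛔 : Matrix (Fin 3) (Fin 3) K) *ᵥ ![(1 : K), 0, -1] = (-1 : K) • ![(1 : K), 0, -1] ∧
      (𝐠₁ : Matrix (Fin 3) (Fin 3) K).det = 1 ∧ (𝛔 : Matrix (Fin 3) (Fin 3) K).det = -1 := by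
  refine ⟨fun p => ?_, fun p => ?_, ?_, ?_, ?_, ?_⟩
  · rw [(mulVec_g₁_σ p).1, hesseE_eval, hesseE_eval]; simp; ring
  · rw [(mulVec_g₁_σ p).2, hesseE_eval, hesseE_eval]; simp; ring
  · ext i j : 1
    fin_cases i <;> fin_cases j <;> simp [Matrix.mul_apply, Fin.sum_univ_three]
  · rw [(mulVec_g₁_σ _).2]; funext i; fin_cases i <;> simp
  · rw [Matrix.det_fin_three]; simp
  · rw [Matrix.det_fin_three]; simp

/-! ## §3 The translation principle for `M_t` (after g20-#3) -/

/-- **The chord–tangent recipe transported along `M_t`** (`3 = 0`, `t ≠ 0`): let `g, σ'` preserve `E_t`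
pointwise (`det ≠ 0`, `σ'² = 1`), `τ` a vector with the point `T ∈ W₃[t](K)` over it
(`M vec T = c_T·τ`, `3T = O`, `σ'τ ∥ τ`), such that for every `p`: `p, τ, σ'p` are collinear and
`M(0,1,0), σ'p, gp` are collinear, with the tangency/degeneracy clauses of the coincident cases.  Then
for all `P, Q`: `M vec Q ∥ g(M vec P)` iff `Q = P + T`.  (Kunz Cor. 10.7 with multiplicities, g20-#1,
applied to both lines.) [cite: ArtebaniDolgachev2009, §2 (the group law), §5 Remark 5.5]
[cite: Kunz2005PlaneAlgebraicCurves, Ch. 10, Cor. 10.7] -/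
theorem charThree_translation_principle [DecidableEq K] (h3 : (3 : K) = 0) (ht : t ≠ 0)
    (hv0 : vec 0 = ![0, 1, 0])
    (hvs : ∀ x y (h : (𝐖₃[t] : WeierstrassCurve K).toAffine.Nonsingular x y), vec (.some x y h) = ![x, y, 1])
    {g σ' : Matrix (Fin 3) (Fin 3) K} (hg : ∀ p : Fin 3 → K, eval (g *ᵥ p) 𝐄[t] = eval p 𝐄[t])
    (hgdet : g.det ≠ 0) (hσ : ∀ p : Fin 3 → K, eval (σ' *ᵥ p) 𝐄[t] = eval p 𝐄[t])
    (hσdet : σ'.det ≠ 0) (hσσ : σ' * σ' = 1)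
    {τ : Fin 3 → K} {T : (𝐖₃[t] : WeierstrassCurve K).toAffine.Point} {cT : K} (hcT : cT ≠ 0)
    (hT : (𝐌[t] : Matrix (Fin 3) (Fin 3) K) *ᵥ vec T = cT • τ) (h3T : 3 • T = 0)
    (hστ : ∃ e : K, σ' *ᵥ τ = e • τ)
    (hdet1 : ∀ p : Fin 3 → K, (Matrix.of ![p, τ, σ' *ᵥ p]).det = 0)
    (hdet2 : ∀ p : Fin 3 → K,
      (Matrix.of ![(𝐌[t] : Matrix (Fin 3) (Fin 3) K) *ᵥ ![0, 1, 0], σ' *ᵥ p, g *ᵥ p]).det = 0)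
    (hcoin1 : ∀ p : Fin 3 → K, p ≠ 0 → eval p 𝐄[t] = 0 → ∀ c : K, σ' *ᵥ p = c • p →
      (fun i => eval p (pderiv i 𝐄[t])) ⬝ᵥ τ = 0 ∨ ∃ d : K, p = d • τ)
    (hcoin2 : ∀ p : Fin 3 → K, p ≠ 0 → eval p 𝐄[t] = 0 → ∀ c : K, σ' *ᵥ p = c • (g *ᵥ p) →
      (fun i => eval (σ' *ᵥ p) (pderiv i 𝐄[t])) ⬝ᵥ ((𝐌[t] : Matrix (Fin 3) (Fin 3) K) *ᵥ ![0, 1, 0]) = 0 ∨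
        ∃ d : K, σ' *ᵥ p = d • ((𝐌[t] : Matrix (Fin 3) (Fin 3) K) *ᵥ ![0, 1, 0]))
    (hS0 : ∀ (p : Fin 3 → K) (c : K), σ' *ᵥ p = c • ((𝐌[t] : Matrix (Fin 3) (Fin 3) K) *ᵥ ![0, 1, 0]) →
      ∃ d : K, g *ᵥ p = d • ((𝐌[t] : Matrix (Fin 3) (Fin 3) K) *ᵥ ![0, 1, 0]))
    (hQ0 : ∀ (p : Fin 3 → K) (c : K), c ≠ 0 → g *ᵥ p = c • ((𝐌[t] : Matrix (Fin 3) (Fin 3) K) *ᵥ ![0, 1, 0]) →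
      ∃ d : K, σ' *ᵥ p = d • ((𝐌[t] : Matrix (Fin 3) (Fin 3) K) *ᵥ ![0, 1, 0]))
    (P Q : (𝐖₃[t] : WeierstrassCurve K).toAffine.Point) :
    (∃ c : K, c ≠ 0 ∧ g *ᵥ ((𝐌[t] : Matrix (Fin 3) (Fin 3) K) *ᵥ vec P) =
        c • ((𝐌[t] : Matrix (Fin 3) (Fin 3) K) *ᵥ vec Q)) ↔ Q = P + T := by
  have hdet : (𝐌[t] : Matrix (Fin 3) (Fin 3) K).det ≠ 0 := by
    rw [charThree_matrix_det ht]; norm_num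
  have hM0 : (𝐌[t] : Matrix (Fin 3) (Fin 3) K) *ᵥ ![0, 1, 0] = (𝐌[t] : Matrix (Fin 3) (Fin 3) K) *ᵥ vec 0 := by
    rw [hv0]
  -- Euler: `⟨∇W(vec R), vec R⟩ = 0`
  have euler : ∀ R : (𝐖₃[t] : WeierstrassCurve K).toAffine.Point,
      (fun j => eval (vec R) (pderiv j (𝐖₃[t] : WeierstrassCurve K).toProjective.polynomial)) ⬝ᵥ
        vec R = 0 :=
    fun R => (weierstrass_grad_dotProduct_eq_zero_iff _ vec hv0 hvs R R).2 (Or.inl rfl)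
  have uniq : ∀ {R R' : (𝐖₃[t] : WeierstrassCurve K).toAffine.Point} {a b : K}, a ≠ 0 →
      a • ((𝐌[t] : Matrix (Fin 3) (Fin 3) K) *ᵥ vec R) = b • ((𝐌[t] : Matrix (Fin 3) (Fin 3) K) *ᵥ vec R') →
      R = R' := by
    intro R R' a b ha hab
    refine point_eq_of_charThreePoint_smul vec ht hv0 hvs (c := a⁻¹ * b) ?_
    rw [← smul_smul, ← hab, smul_smul, inv_mul_cancel₀ ha, one_smul]
  have key : ∀ Q : (𝐖₃[t] : WeierstrassCurve K).toAffine.Point, (∃ c : K, c ≠ 0 ∧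
      g *ᵥ ((𝐌[t] : Matrix (Fin 3) (Fin 3) K) *ᵥ vec P) =
        c • ((𝐌[t] : Matrix (Fin 3) (Fin 3) K) *ᵥ vec Q)) → Q = P + T := by
    rintro Q ⟨c, hc, hcQ⟩
    obtain ⟨hp, hpE⟩ := charThreePoint_ne_zero_and_eval vec h3 ht hv0 hvs P
    obtain ⟨S, cs, hcs, hS⟩ := exists_point_image₃ vec h3 ht hv0 hvs hσ hσdet P
    -- Step 1: `P + T + S = O`
    have hsum1 : P + T + S = 0 := by
      refine weierstrass_add_add_eq_zero_of_intersectionCycle _ vec hv0 hvs ?_ ?_ ?_ ?_ ?_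
      · have h1 := hdet1 ((𝐌[t] : Matrix (Fin 3) (Fin 3) K) *ᵥ vec P)
        have h2 : (Matrix.of ![(𝐌[t] : Matrix (Fin 3) (Fin 3) K) *ᵥ vec P,
            (𝐌[t] : Matrix (Fin 3) (Fin 3) K) *ᵥ vec T, σ' *ᵥ ((𝐌[t] : Matrix (Fin 3) (Fin 3) K) *ᵥ vec P)]).det = 0 := by
          rw [hT, (det_rows_smul₃ cT _ _ _).1, h1, mul_zero]
        rw [hS, (det_rows_smul₃ cs _ _ _).2.1, det_rows_charThreeM_mulVec] at h2
        rcases mul_eq_zero.1 h2 with h2 | h2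
        · exact absurd h2 hcs
        · exact (mul_eq_zero.1 h2).resolve_left hdet
      · rintro rfl
        obtain ⟨e, he⟩ := hστ
        have hSP : S = P := by
          refine uniq (R := S) (R' := P) (a := cs) (b := e) hcs ?_
          rw [← hS, hT, Matrix.mulVec_smul, he, smul_smul, smul_smul, mul_comm]
        rw [hSP]; exact euler P
      · rintro rfl
        rcases hcoin1 _ hp hpE cs hS with h | ⟨d, hd⟩
        · have h' : (fun i => eval ((𝐌[t] : Matrix (Fin 3) (Fin 3) K) *ᵥ vec P) (pderiv i 𝐄[t])) ⬝ᵥ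
              ((𝐌[t] : Matrix (Fin 3) (Fin 3) K) *ᵥ vec T) = 0 := by
            rw [hT, dotProduct_smul, h, smul_zero]
          rw [charThree_grad_M_dotProduct h3 ht, neg_eq_zero] at h'
          exact h'
        · have hd0 : d ≠ 0 := by rintro rfl; exact hp (by rw [hd, zero_smul])
          have hPT : P = T := uniq (R := P) (R' := T) (a := cT) (b := d) hcT
            (by rw [hd, hT, smul_smul, smul_smul, mul_comm])
          subst hPT; exact euler P
      · rintro rfl
        obtain ⟨e, he⟩ := hστ
        have hPT : P = T := by
          refine uniq (a := (1 : K)) (b := cs * e) one_ne_zero ?_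
          have e1 : (𝐌[t] : Matrix (Fin 3) (Fin 3) K) *ᵥ vec P =
              σ' *ᵥ (σ' *ᵥ ((𝐌[t] : Matrix (Fin 3) (Fin 3) K) *ᵥ vec P)) := by
            rw [Matrix.mulVec_mulVec, hσσ, Matrix.one_mulVec]
          have e2 : τ = cT⁻¹ • ((𝐌[t] : Matrix (Fin 3) (Fin 3) K) *ᵥ vec T) := by
            rw [hT, smul_smul, inv_mul_cancel₀ hcT, one_smul]
          rw [one_smul, e1, hS, Matrix.mulVec_smul, hT, Matrix.mulVec_smul, he, e2]
          simp only [smul_smul]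
          congr 1
          field_simp
        subst hPT; exact euler P
      · rintro rfl _; exact h3T
    -- Step 2: `O + S + Q = O`
    have hsum2 : (0 : (𝐖₃[t] : WeierstrassCurve K).toAffine.Point) + S + Q = 0 := by
      refine weierstrass_add_add_eq_zero_of_intersectionCycle _ vec hv0 hvs ?_ ?_ ?_ ?_ ?_
      · have h1 := hdet2 ((𝐌[t] : Matrix (Fin 3) (Fin 3) K) *ᵥ vec P)
        rw [hS, hcQ, hM0, (det_rows_smul₃ cs _ _ _).1, (det_rows_smul₃ c _ _ _).2.1,
          det_rows_charThreeM_mulVec] at h1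
        rcases mul_eq_zero.1 h1 with h1 | h1
        · exact absurd h1 hcs
        rcases mul_eq_zero.1 h1 with h1 | h1
        · exact absurd h1 hc
        · exact (mul_eq_zero.1 h1).resolve_left hdet
      · rintro h0S
        obtain ⟨d, hd⟩ := hS0 _ (cs * 1) (by rw [hS, ← h0S, hM0, mul_one])
        have hd0 : d ≠ 0 := by
          rintro rfl
          rw [zero_smul] at hd
          rw [hd] at hcQ
          exact (charThreePoint_ne_zero_and_eval vec h3 ht hv0 hvs Q).1
            ((smul_eq_zero.1 hcQ.symm).resolve_left hc)
        have hQ : Q = 0 := uniq (a := c) (b := d) hc (by rw [← hcQ, hd, hM0])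
        rw [hQ]; exact euler 0
      · rintro h0Q
        obtain ⟨d, hd⟩ := hQ0 _ c hc (by rw [hcQ, ← h0Q, hM0])
        have hd0 : d ≠ 0 := by
          rintro rfl
          rw [zero_smul] at hd
          rw [hd] at hS
          exact (charThreePoint_ne_zero_and_eval vec h3 ht hv0 hvs S).1
            ((smul_eq_zero.1 hS.symm).resolve_left hcs)
        have hS' : S = 0 := uniq (a := cs) (b := d) hcs (by rw [← hS, hd, hM0])
        rw [hS']; exact euler 0
      · intro hSQ
        subst hSQ
        have hpar : σ' *ᵥ ((𝐌[t] : Matrix (Fin 3) (Fin 3) K) *ᵥ vec P) =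
            (cs * c⁻¹) • (g *ᵥ ((𝐌[t] : Matrix (Fin 3) (Fin 3) K) *ᵥ vec P)) := by
          rw [hS, hcQ, smul_smul, mul_assoc, inv_mul_cancel₀ hc, mul_one]
        rcases hcoin2 _ hp hpE _ hpar with h | ⟨d, hd⟩
        · rw [hS, (hesseE_eval_grad_smul t cs _ _).2, hM0, charThree_grad_M_dotProduct h3 ht,
            mul_eq_zero, neg_eq_zero] at h
          rcases h with h | h
          · exact absurd h (pow_ne_zero 2 hcs)
          · exact h
        · have hS' : S = 0 := uniq (a := cs) (b := d) hcs (by rw [← hS, hd, hM0])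
          subst hS'; exact euler 0
      · intro _ _; simp
    rw [zero_add] at hsum2
    rw [eq_neg_of_add_eq_zero_right hsum2, eq_neg_of_add_eq_zero_right hsum1, neg_neg]
  refine ⟨key Q, fun hQ => ?_⟩
  obtain ⟨Q', c, hc, hcQ'⟩ := exists_point_image₃ vec h3 ht hv0 hvs hg hgdet P
  rw [hQ, ← key Q' ⟨c, hc, hcQ'⟩]
  exact ⟨c, hc, hcQ'⟩

/-! ## §4 Remark 5.5: `g₁` is the translation by the `3`-torsion point over `(1, 0, −1)` -/

/-- **The base point `t₀ = (1, 0, −1)` is a point of `W₃[t](K)`**: there is `T ∈ W₃[t](K)` with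
`M vec T = c_T·(1, 0, −1)`, `c_T ≠ 0` (`3 = 0`, `t ≠ 0`). [cite: ArtebaniDolgachev2009, §2, Remark 2.1
(the base point `(1, 0, −1)`)] -/
theorem exists_point_t₀_charThree (h3 : (3 : K) = 0) (ht : t ≠ 0) (hv0 : vec 0 = ![0, 1, 0])
    (hvs : ∀ x y (h : (𝐖₃[t] : WeierstrassCurve K).toAffine.Nonsingular x y), vec (.some x y h) = ![x, y, 1]) :
    ∃ (T : (𝐖₃[t] : WeierstrassCurve K).toAffine.Point) (cT : K),
      cT ≠ 0 ∧ (𝐌[t] : Matrix (Fin 3) (Fin 3) K) *ᵥ vec T = cT • ![(1 : K), 0, -1] := by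
  have hE : eval ![(1 : K), 0, -1] 𝐄[t] = 0 := by simp; norm_num
  obtain ⟨T, c, hc, hcT⟩ := exists_point_of_hesseE_charThree vec h3 ht hv0 hvs
    (p := ![(1 : K), 0, -1]) (fun h0 => by simpa using congrFun h0 0) hE
  exact ⟨T, c⁻¹, inv_ne_zero hc, by rw [hcT, smul_smul, inv_mul_cancel₀ hc, one_smul]⟩

/-- **`T` is a `3`-torsion point: `3T = O`** — the inflection tangent at `t₀` meets `E_t` only at `t₀`
(`hesseE_inflectionTangent_t₀_of_three_eq_zero`), transported by g20-#1's
`weierstrass_tangent_meets_only_iff`. [cite: ArtebaniDolgachev2009, §5, Remark 5.5 ("translation by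
3-torsion points")] -/
theorem three_nsmul_T₀_charThree [DecidableEq K] (h3 : (3 : K) = 0) (ht : t ≠ 0)
    (hv0 : vec 0 = ![0, 1, 0])
    (hvs : ∀ x y (h : (𝐖₃[t] : WeierstrassCurve K).toAffine.Nonsingular x y), vec (.some x y h) = ![x, y, 1])
    {T : (𝐖₃[t] : WeierstrassCurve K).toAffine.Point} {cT : K} (hcT : cT ≠ 0)
    (hT : (𝐌[t] : Matrix (Fin 3) (Fin 3) K) *ᵥ vec T = cT • ![(1 : K), 0, -1]) : 3 • T = 0 := by
  refine (weierstrass_tangent_meets_only_iff _ vec hv0 hvs T).1 fun Q hQ => ?_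
  obtain ⟨hq, hqE⟩ := charThreePoint_ne_zero_and_eval vec h3 ht hv0 hvs Q
  have h1 : (fun i => eval ((𝐌[t] : Matrix (Fin 3) (Fin 3) K) *ᵥ vec T) (pderiv i 𝐄[t])) ⬝ᵥ
      ((𝐌[t] : Matrix (Fin 3) (Fin 3) K) *ᵥ vec Q) = 0 := by
    rw [charThree_grad_M_dotProduct h3 ht, hQ, neg_zero]
  rw [hT, (hesseE_eval_grad_smul t cT _ _).2, mul_eq_zero] at h1
  have h2 := h1.resolve_left (pow_ne_zero 2 hcT)
  obtain ⟨c, hc⟩ := hesseE_inflectionTangent_t₀_of_three_eq_zero h3 ht _ hqE h2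
  refine point_eq_of_charThreePoint_smul vec ht hv0 hvs (c := c * cT⁻¹) ?_
  rw [hc, hT, smul_smul, mul_assoc, inv_mul_cancel₀ hcT, mul_one]

/-- **Artebani–Dolgachev, Remark 5.5: "In characteristic 3 the cyclic group of projective
transformations generated by `g₁` acts on nonsingular members of the Hesse pencil as translation by
3-torsion points with the zero point taken to be `(1, −1, 0)`."**  For `3 = 0`, `t ≠ 0`, the member
`E_t` with its Weierstrass model `W₃[t]` through `M_t` (zero `M_t(0,1,0) ∥ (1, −1, 0)`), the point
`T ∈ W₃[t](K)` over `(1, 0, −1)` (`3T = O`) and all `P, Q ∈ W₃[t](K)`: the Hesse point `M vec Q` is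
`g₁(M vec P) = (y, z, x)` up to a non-zero scalar iff `Q = P + T`.  [cite: ArtebaniDolgachev2009, §5,
Remark 5.5] -/
theorem hesseE_translation_g₁_iff_of_three_eq_zero [DecidableEq K] (h3 : (3 : K) = 0) (ht : t ≠ 0)
    (hv0 : vec 0 = ![0, 1, 0])
    (hvs : ∀ x y (h : (𝐖₃[t] : WeierstrassCurve K).toAffine.Nonsingular x y), vec (.some x y h) = ![x, y, 1])
    {T : (𝐖₃[t] : WeierstrassCurve K).toAffine.Point} {cT : K} (hcT : cT ≠ 0)
    (hT : (𝐌[t] : Matrix (Fin 3) (Fin 3) K) *ᵥ vec T = cT • ![(1 : K), 0, -1])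
    (P Q : (𝐖₃[t] : WeierstrassCurve K).toAffine.Point) :
    (∃ c : K, c ≠ 0 ∧ (𝐠₁ : Matrix (Fin 3) (Fin 3) K) *ᵥ ((𝐌[t] : Matrix (Fin 3) (Fin 3) K) *ᵥ vec P) =
        c • ((𝐌[t] : Matrix (Fin 3) (Fin 3) K) *ᵥ vec Q)) ↔ Q = P + T := by
  obtain ⟨hg, hσ, hσσ, hσt, hgdet, hσdet⟩ := hesseE_eval_g₁_σ (K := K) t
  refine charThree_translation_principle vec h3 ht hv0 hvs hg (by rw [hgdet]; exact one_ne_zero) hσ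
    (by rw [hσdet]; norm_num) hσσ hcT hT (three_nsmul_T₀_charThree vec h3 ht hv0 hvs hcT hT)
    ⟨-1, hσt⟩ det_p_t₀_σ (fun p => (det_o_σ_g₁ t p).2) (fun p _ _ c hc => ?_) (fun p _ _ c hc => ?_)
    (fun p c hc => ?_) (fun p c _ hc => ?_) P Q
  · exact Or.inl ((hesseE_grad_dotProduct_t₀_of_three_eq_zero h3 t p).2 c hc)
  · left
    rw [charThreeM_mulVec_e₁]
    have h := (hesseE_grad_dotProduct_o_of_three_eq_zero h3 t p).2 c hc
    have e : (![t⁻¹, -t⁻¹, 0] : Fin 3 → K) = t⁻¹ • ![(1 : K), -1, 0] := by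
      funext i; fin_cases i <;> simp
    rw [e, dotProduct_smul, h, smul_zero]
  · -- `σ p ∥ M(0,1,0)`: `p = (0, −c t⁻¹, c t⁻¹)`-shaped, so `g₁ p = −σ p`
    refine ⟨-c, ?_⟩
    rw [charThreeM_mulVec_e₁] at hc ⊢
    rw [(mulVec_g₁_σ p).2] at hc
    rw [(mulVec_g₁_σ p).1]
    have e0 : p 2 = c * t⁻¹ := by simpa using congrFun hc 0
    have e1 : p 1 = c * -t⁻¹ := by simpa using congrFun hc 1
    have e2 : p 0 = 0 := by simpa using congrFun hc 2
    funext i; fin_cases i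
    · simp [e1]
    · simp [e0]
    · simp [e2]
  · refine ⟨-c, ?_⟩
    rw [charThreeM_mulVec_e₁] at hc ⊢
    rw [(mulVec_g₁_σ p).1] at hc
    rw [(mulVec_g₁_σ p).2]
    have e0 : p 1 = c * t⁻¹ := by simpa using congrFun hc 0
    have e1 : p 2 = c * -t⁻¹ := by simpa using congrFun hc 1
    have e2 : p 0 = 0 := by simpa using congrFun hc 2
    funext i; fin_cases i
    · simp [e1]
    · simp [e0]
    · simp [e2]


/-! ## §5 The three base points are `O, T, 2T` -/

/-- **`2T` lies over the third base point `(0, 1, −1)`**: `M vec (T + T) = c·(0, 1, −1)`, `c ≠ 0` —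
`g₁(1, 0, −1) = (0, −1, 1)` and `g₁` is the translation by `T` (§4). [cite: ArtebaniDolgachev2009,
§5, Remark 5.5 ("translation by 3-torsion points"); §2, Remark 2.1 ("three base points")] -/
theorem hesseE_two_nsmul_T₀_charThree [DecidableEq K] (h3 : (3 : K) = 0) (ht : t ≠ 0)
    (hv0 : vec 0 = ![0, 1, 0])
    (hvs : ∀ x y (h : (𝐖₃[t] : WeierstrassCurve K).toAffine.Nonsingular x y), vec (.some x y h) = ![x, y, 1])
    {T : (𝐖₃[t] : WeierstrassCurve K).toAffine.Point} {cT : K} (hcT : cT ≠ 0)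
    (hT : (𝐌[t] : Matrix (Fin 3) (Fin 3) K) *ᵥ vec T = cT • ![(1 : K), 0, -1]) :
    ∃ c : K, c ≠ 0 ∧ (𝐌[t] : Matrix (Fin 3) (Fin 3) K) *ᵥ vec (T + T) = c • ![(0 : K), 1, -1] := by
  obtain ⟨c, hc, h⟩ :=
    (hesseE_translation_g₁_iff_of_three_eq_zero vec h3 ht hv0 hvs hcT hT T (T + T)).2 rfl
  have e : (𝐠₁ : Matrix (Fin 3) (Fin 3) K) *ᵥ ((𝐌[t] : Matrix (Fin 3) (Fin 3) K) *ᵥ vec T) =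
      (-cT) • ![(0 : K), 1, -1] := by
    rw [hT, Matrix.mulVec_smul, (mulVec_g₁_σ _).1]
    funext i; fin_cases i <;> simp
  refine ⟨c⁻¹ * -cT, mul_ne_zero (inv_ne_zero hc) (neg_ne_zero.2 hcT), ?_⟩
  calc (𝐌[t] : Matrix (Fin 3) (Fin 3) K) *ᵥ vec (T + T)
      = c⁻¹ • (c • ((𝐌[t] : Matrix (Fin 3) (Fin 3) K) *ᵥ vec (T + T))) := by
        rw [smul_smul, inv_mul_cancel₀ hc, one_smul]
    _ = c⁻¹ • ((-cT) • ![(0 : K), 1, -1]) := by rw [← h, e]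
    _ = (c⁻¹ * -cT) • ![(0 : K), 1, -1] := smul_smul _ _ _

/-- **The three base points of the pencil in characteristic `3` are `O`, `T`, `2T`** (Remark 2.1: "any
curve has only three base points"; Remark 5.5: `⟨g₁⟩` acts by translation by `3`-torsion points): for
`P ∈ W₃[t](K)` the Hesse point `M vec P = (x, y, z)` lies on the triangle `xyz = 0` iff
`P ∈ {O, T, T + T}`; in particular such `P` satisfy `3P = O`. [cite: ArtebaniDolgachev2009, §2,
Remark 2.1; §5, Remark 5.5] -/
theorem hesseE_basePoint_iff_charThree [DecidableEq K] (h3 : (3 : K) = 0) (ht : t ≠ 0)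
    (hv0 : vec 0 = ![0, 1, 0])
    (hvs : ∀ x y (h : (𝐖₃[t] : WeierstrassCurve K).toAffine.Nonsingular x y), vec (.some x y h) = ![x, y, 1])
    {T : (𝐖₃[t] : WeierstrassCurve K).toAffine.Point} {cT : K} (hcT : cT ≠ 0)
    (hT : (𝐌[t] : Matrix (Fin 3) (Fin 3) K) *ᵥ vec T = cT • ![(1 : K), 0, -1])
    (P : (𝐖₃[t] : WeierstrassCurve K).toAffine.Point) :
    (((𝐌[t] : Matrix (Fin 3) (Fin 3) K) *ᵥ vec P) 0 * ((𝐌[t] : Matrix (Fin 3) (Fin 3) K) *ᵥ vec P) 1 *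
        ((𝐌[t] : Matrix (Fin 3) (Fin 3) K) *ᵥ vec P) 2 = 0 ↔ P = 0 ∨ P = T ∨ P = T + T) ∧
      (P = 0 ∨ P = T ∨ P = T + T → 3 • P = 0) := by
  obtain ⟨c2, hc2, h2T⟩ := hesseE_two_nsmul_T₀_charThree vec h3 ht hv0 hvs hcT hT
  have h0 : (𝐌[t] : Matrix (Fin 3) (Fin 3) K) *ᵥ vec 0 = t⁻¹ • ![(1 : K), -1, 0] := by
    rw [hv0, charThree_matrix_mulVec_O]
  have h3T : 3 • T = 0 := three_nsmul_T₀_charThree vec h3 ht hv0 hvs hcT hT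
  -- two Hesse points that are proportional are the same point (scalar on the right)
  have uniq : ∀ {R R' : (𝐖₃[t] : WeierstrassCurve K).toAffine.Point} {a b : K}, a ≠ 0 →
      a • ((𝐌[t] : Matrix (Fin 3) (Fin 3) K) *ᵥ vec R) = b • ((𝐌[t] : Matrix (Fin 3) (Fin 3) K) *ᵥ vec R') →
      R = R' := by
    intro R R' a b ha hab
    refine point_eq_of_charThreePoint_smul vec ht hv0 hvs (c := a⁻¹ * b) ?_
    rw [← smul_smul, ← hab, smul_smul, inv_mul_cancel₀ ha, one_smul]
  refine ⟨⟨fun hπ => ?_, fun hP => ?_⟩, fun hP => ?_⟩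
  · obtain ⟨hp, hpE⟩ := charThreePoint_ne_zero_and_eval vec h3 ht hv0 hvs P
    have hS : ((𝐌[t] : Matrix (Fin 3) (Fin 3) K) *ᵥ vec P) 0 ^ 3 +
        ((𝐌[t] : Matrix (Fin 3) (Fin 3) K) *ᵥ vec P) 1 ^ 3 +
        ((𝐌[t] : Matrix (Fin 3) (Fin 3) K) *ᵥ vec P) 2 ^ 3 = 0 := by
      rw [hesseE_eval, hπ, mul_zero, add_zero] at hpE; exact hpE
    obtain ⟨c, hc, h | h | h⟩ := hesse_basePoint_cases_of_three_eq_zero h3 hp hπ hS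
    · -- `(0, 1, −1)`: `P = T + T`
      refine Or.inr (Or.inr (uniq (a := c2) (b := c) hc2 ?_))
      rw [h, h2T, smul_smul, smul_smul, mul_comm]
    · -- `(1, 0, −1)`: `P = T`
      refine Or.inr (Or.inl (uniq (a := cT) (b := c) hcT ?_))
      rw [h, hT, smul_smul, smul_smul, mul_comm]
    · -- `(1, −1, 0)`: `P = O`
      refine Or.inl (uniq (a := t⁻¹) (b := c) (inv_ne_zero ht) ?_)
      rw [h, h0, smul_smul, smul_smul, mul_comm]
  · rcases hP with rfl | rfl | rfl
    · rw [h0]; simp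
    · rw [hT]; simp
    · rw [h2T]; simp
  · rcases hP with rfl | rfl | rfl
    · simp
    · exact h3T
    · rw [← two_nsmul, smul_smul]
      rw [show (3 * 2 : ℕ) = 2 * 3 from rfl, ← smul_smul, h3T, smul_zero]

end CharThreeTranslation

end Literature.AlgebraicGeometry.PlaneCurves
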